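import Literature.AlgebraicGeometry.Resolution.TameTowerRebase
import Mathlib.GroupTheory.Perm.Cycle.Type
import Mathlib.Order.Preorder.Finite
import HarnessLib

/-!
# Towers of Galois extensions of prime degree below an abelian quotient of order prime to `p`

Topic: `Literature/AlgebraicGeometry/Resolution` (valued function fields / ramification theory).
The Galois-theoretic bookkeeping behind the TAME part `Fⁱ → Fʳ` of the ramification tower in
V. Cossart, O. Piltant, *Resolution of singularities of threefolds in positive characteristic I*,
J. Algebra 320 (2008), proof of Thm. 8.1 (HAL preprint hal-00139124: Thm. 7.2, p. 20):

> By (8), `K₀ʳ/K₀ⁱ` is an Abelian extension of order prime to `p`, whence a tower of Abelian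
> extensions of prime degrees `lᵢ ≠ p`. Therefore, using induction on `[K₀ʳ : K₀ⁱ]` …

(re-used verbatim in Cossart–Piltant 2019, proof of Prop. 4.10: "`Fʳ|Fⁱ` is an Abelian
extension of order prime to `p` … a tower of ramified Galois extensions of prime degrees
`l ≠ p`"). In the ambient style of `TameTowerRebase.lean` / `TameTowerPGroupTowers.lean`
(subfields of one field `Ω`; `L | M` finite Galois inside `Ω` with group `G`):

* `exists_normal_prime_relIndex_of_commutator_mem` — group theory: if `K < H` are subgroups
  of a finite group with `[H, H] ≤ K`, some `H' ⊇ K`, normalised by `H`, has prime index in `H`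
  (a maximal element of `[K, H)`; Cauchy).
* `IsPrimeGaloisStep p`, `IsPrimeGaloisTower p` — "Galois extension of prime degree `ℓ ≠ p`"
  and finite towers of such, as predicates on pairs of subfields of `Ω` (cf. `IsNormalStep`,
  `IsNormalPTower` of `HenselizedFunctionFields.lean`).
* `exists_rebaseAutEquiv` — rebasing `L` over an intermediate field `S`: the Galois group of
  `L | S` (inside `Ω`) IS the subgroup of `G` fixing `S`, compatibly with the action on `Ω`
  (`TameTowerRebase.exists_rebaseAutHom` with bijectivity and the pointwise identification).
* `isPrimeGaloisTower_fixedField` — **for subgroups `B ≤ A ≤ G` with `[A, A] ≤ B` and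
  `p ∤ (A : B)`, the fixed field of `B` is reached from the fixed field of `A` by a tower of
  Galois extensions of prime degrees `≠ p`.** (Applied to `A = G_T ⊇ B = G_V`, the inertia and
  ramification groups of a valuation, `KrullRamificationGroups.lean`, this is the displayed
  sentence.)

Everything is PROVED; standard Galois theory ([folklore]) organised after the source.

## Sources

* V. Cossart, O. Piltant, J. Algebra 320 (2008) 1051–1082, proof of Thm. 8.1 (HAL: Thm. 7.2,
  p. 20). [CossartPiltant2008]
-/

noncomputable section

open Module IntermediateField

namespace Literature.AlgebraicGeometry.Resolution

universe u

/-! ### Group theory: a normal subgroup of prime index below an abelian quotient -/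

/-- **In a finite group, if `K < H` and `H/K` is abelian (all commutators of `H` lie in `K`),
there is a subgroup `K ≤ H' < H`, normalised by `H`, of prime index in `H`**: take `H'` maximal
in `[K, H)`; it contains `[H, H]`, and `H/H'`, having no non-trivial proper subgroups, is cyclic
of prime order (Cauchy). [folklore] -/
theorem exists_normal_prime_relIndex_of_commutator_mem {G : Type*} [Group G] [Finite G]
    {K H : Subgroup G} (hKH : K < H)
    (hcomm : ∀ s ∈ H, ∀ t ∈ H, s * t * s⁻¹ * t⁻¹ ∈ K) :
    ∃ H' : Subgroup G, K ≤ H' ∧ H' < H ∧ (∀ s ∈ H, ∀ h ∈ H', s * h * s⁻¹ ∈ H') ∧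
      (H'.relIndex H).Prime := by
  classical
  haveI : Finite (Subgroup G) :=
    Finite.of_injective (fun P : Subgroup G => (P : Set G)) SetLike.coe_injective
  set S : Set (Subgroup G) := {H' | K ≤ H' ∧ H' < H} with hS
  have hSfin : S.Finite := Set.toFinite S
  obtain ⟨H', hH'max⟩ := Set.Finite.exists_maximal hSfin ⟨K, ⟨le_rfl, hKH⟩⟩
  obtain ⟨hKH', hH'H⟩ : K ≤ H' ∧ H' < H := hH'max.1
  have hmax' : ∀ P : Subgroup G, K ≤ P → P < H → ¬ H' < P := fun P h1 h2 hlt =>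
    (lt_iff_le_not_ge.mp hlt).2 (hH'max.2 (show P ∈ S from ⟨h1, h2⟩) (lt_iff_le_not_ge.mp hlt).1)
  -- normality in `H`
  have hnorm : ∀ s ∈ H, ∀ h ∈ H', s * h * s⁻¹ ∈ H' := by
    intro s hs h hh
    have h1 : s * h * s⁻¹ * h⁻¹ ∈ H' := hKH' (hcomm s hs h (hH'H.le hh))
    have h2 : s * h * s⁻¹ = (s * h * s⁻¹ * h⁻¹) * h := by group
    rw [h2]
    exact H'.mul_mem h1 hh
  refine ⟨H', hKH', hH'H, hnorm, ?_⟩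
  -- the quotient `H / H'` has prime order
  haveI hN : (H'.subgroupOf H).Normal := by
    refine ⟨fun h hh s => ?_⟩
    rw [Subgroup.mem_subgroupOf] at hh ⊢
    simpa using hnorm s s.2 h hh
  have hne : H'.relIndex H ≠ 1 := by
    rw [Ne, Subgroup.relIndex_eq_one]
    exact not_le_of_gt hH'H
  obtain ⟨ℓ, hℓ, hdvd⟩ := Nat.exists_prime_and_dvd hne
  haveI : Fact ℓ.Prime := ⟨hℓ⟩
  have hdvd' : ℓ ∣ Nat.card (H ⧸ H'.subgroupOf H) := by
    rwa [← Subgroup.index_eq_card]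
  obtain ⟨g, hg⟩ := exists_prime_orderOf_dvd_card' ℓ hdvd'
  -- the preimage of `⟨g⟩` in `G`
  let Q : Subgroup H := (Subgroup.zpowers g).comap (QuotientGroup.mk' (H'.subgroupOf H))
  let P : Subgroup G := Q.map H.subtype
  have hPH : P ≤ H := by
    rintro _ ⟨x, -, rfl⟩
    exact x.2
  have hH'P : H' ≤ P := by
    intro x hx
    refine ⟨⟨x, hH'H.le hx⟩, ?_, rfl⟩
    change QuotientGroup.mk' (H'.subgroupOf H) ⟨x, hH'H.le hx⟩ ∈ Subgroup.zpowers g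
    rw [QuotientGroup.mk'_apply, (QuotientGroup.eq_one_iff _).mpr
      (by rw [Subgroup.mem_subgroupOf]; exact hx)]
    exact one_mem _
  have hneP : H' ≠ P := by
    intro hH'P'
    obtain ⟨x, rfl⟩ := QuotientGroup.mk'_surjective (H'.subgroupOf H) g
    have hxP : (x : G) ∈ P := ⟨x, Subgroup.mem_zpowers _, rfl⟩
    rw [← hH'P'] at hxP
    have h1 : QuotientGroup.mk' (H'.subgroupOf H) x = 1 := by
      rw [QuotientGroup.mk'_apply]
      exact (QuotientGroup.eq_one_iff x).mpr (Subgroup.mem_subgroupOf.mpr hxP)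
    rw [h1, orderOf_one] at hg
    exact hℓ.one_lt.ne' hg.symm
  have hPtop : P = H := by
    by_contra hPH'
    exact hmax' P (hKH'.trans hH'P) (lt_of_le_of_ne hPH hPH') (lt_of_le_of_ne hH'P hneP)
  have hQtop : Q = ⊤ := by
    apply le_antisymm le_top
    intro x _
    have hx : (x : G) ∈ P := by rw [hPtop]; exact x.2
    obtain ⟨y, hy, hyx⟩ := hx
    have : y = x := Subtype.ext hyx
    rwa [← this]
  have hztop : Subgroup.zpowers g = ⊤ := by
    have := Subgroup.comap_injective (QuotientGroup.mk'_surjective (H'.subgroupOf H))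
    apply this
    rw [Subgroup.comap_top]
    exact hQtop
  rw [Subgroup.relIndex, Subgroup.index_eq_card,
    ← Subgroup.card_top (G := H ⧸ H'.subgroupOf H), ← hztop, Nat.card_zpowers, hg]
  exact hℓ

/-! ### Galois steps of prime degree `≠ p` and towers of them -/

variable {Ω : Type u} [Field Ω]

/-- **Galois extension of prime degree `ℓ ≠ p`** inside `Ω`: `M ≤ T` with `T | M` Galois of
prime degree different from `p` ("Abelian extensions of prime degrees `lᵢ ≠ p`").
[cite: CossartPiltant2008, proof of Thm. 8.1 (HAL Thm. 7.2, p. 20)] -/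
def IsPrimeGaloisStep (p : ℕ) (M T : Subfield Ω) : Prop :=
  ∃ h : M ≤ T, ∃ ℓ : ℕ, ℓ.Prime ∧ ℓ ≠ p ∧
    Module.finrank M (Subfield.extendScalars h) = ℓ ∧ IsGalois M (Subfield.extendScalars h)

/-- **Finite tower of Galois extensions of prime degrees `≠ p`** from `M` up to `T` inside `Ω`,
as an inductive predicate ("whence a tower of Abelian extensions of prime degrees `lᵢ ≠ p`").
[cite: CossartPiltant2008, proof of Thm. 8.1 (HAL Thm. 7.2, p. 20)] -/
inductive IsPrimeGaloisTower (p : ℕ) : Subfield Ω → Subfield Ω → Prop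
  | refl (M : Subfield Ω) : IsPrimeGaloisTower p M M
  | step {M M₁ T : Subfield Ω} :
      IsPrimeGaloisStep p M M₁ → IsPrimeGaloisTower p M₁ T → IsPrimeGaloisTower p M T

/-- `M ≤ T` along a step. [folklore] -/
theorem IsPrimeGaloisStep.le {p : ℕ} {M T : Subfield Ω} (h : IsPrimeGaloisStep p M T) : M ≤ T :=
  h.1

/-- `M ≤ T` along a tower. [folklore] -/
theorem IsPrimeGaloisTower.le {p : ℕ} {M T : Subfield Ω} (h : IsPrimeGaloisTower p M T) :
    M ≤ T := by
  induction h with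
  | refl M => exact le_rfl
  | step h₁ _ ih => exact h₁.le.trans ih

/-- Towers concatenate. [folklore] -/
theorem IsPrimeGaloisTower.trans {p : ℕ} {M T T' : Subfield Ω} (h : IsPrimeGaloisTower p M T)
    (h' : IsPrimeGaloisTower p T T') : IsPrimeGaloisTower p M T' := by
  induction h with
  | refl M => exact h'
  | step h₁ _ ih => exact IsPrimeGaloisTower.step h₁ (ih h')

/-! ### Rebasing: the Galois group over an intermediate field, with its action on `Ω` -/

section Rebase

variable {M : Subfield Ω} {L : IntermediateField M Ω} (S : IntermediateField M L)

/-- **The Galois group of `L` over `lift S` is the subgroup of `Gal(L|M)` fixing `S`**, by an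
isomorphism compatible with the actions on the elements of `L ⊆ Ω` (`L | M` finite Galois).
[folklore] -/
theorem exists_rebaseAutEquiv [FiniteDimensional M L] [IsGalois M L] :
    ∃ ψ : (Subfield.extendScalars (lift_toSubfield_le S) ≃ₐ[(lift S).toSubfield]
        Subfield.extendScalars (lift_toSubfield_le S)) ≃* S.fixingSubgroup,
      ∀ σ (x : L), ((((ψ σ : S.fixingSubgroup) : L ≃ₐ[M] L) x : L) : Ω) =
        ((σ ⟨(x : Ω), (mem_extendScalars_lift_iff S x).mpr x.2⟩ :
          Subfield.extendScalars (lift_toSubfield_le S)) : Ω) := by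
  obtain ⟨f, g, hfg, hf, hg⟩ := exists_rebase_equiv S
  have hg' : ∀ y : Subfield.extendScalars (lift_toSubfield_le S), ((g.symm y : L) : Ω) = y :=
    fun y => by conv_rhs => rw [← g.apply_symm_apply y]; rw [hg]
  have hgx : ∀ x : L, g x = ⟨(x : Ω), (mem_extendScalars_lift_iff S x).mpr x.2⟩ :=
    fun x => Subtype.ext (hg x)
  -- `g` identifies the two structure maps out of `M`
  have hgM : ∀ c : M, g (algebraMap M L c) =
      algebraMap (lift S).toSubfield (Subfield.extendScalars (lift_toSubfield_le S))
        ⟨c, le_lift_toSubfield S c.2⟩ := fun c => Subtype.ext (by rw [hg]; rfl)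
  have hgS : ∀ x : L, x ∈ S → ∃ c : (lift S).toSubfield, g x =
      algebraMap (lift S).toSubfield (Subfield.extendScalars (lift_toSubfield_le S)) c :=
    fun x hx => ⟨⟨x, (mem_lift x).mpr hx⟩, Subtype.ext (by rw [hg]; rfl)⟩
  let φ₀ : (Subfield.extendScalars (lift_toSubfield_le S) ≃ₐ[(lift S).toSubfield]
      Subfield.extendScalars (lift_toSubfield_le S)) → (L ≃ₐ[M] L) := fun σ =>
    AlgEquiv.ofRingEquiv (f := (g.trans σ.toRingEquiv).trans g.symm) (fun c => by
      change g.symm (σ (g (algebraMap M L c))) = algebraMap M L c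
      rw [hgM, AlgEquiv.commutes, ← hgM, RingEquiv.symm_apply_apply])
  have hφ₀ : ∀ σ (x : L), φ₀ σ x = g.symm (σ (g x)) := fun _ _ => rfl
  let φ : (Subfield.extendScalars (lift_toSubfield_le S) ≃ₐ[(lift S).toSubfield]
      Subfield.extendScalars (lift_toSubfield_le S)) →* (L ≃ₐ[M] L) :=
    { toFun := φ₀
      map_one' := AlgEquiv.ext fun x => by
        rw [hφ₀, AlgEquiv.one_apply, AlgEquiv.one_apply, RingEquiv.symm_apply_apply]
      map_mul' := fun σ τ => AlgEquiv.ext fun x => by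
        rw [AlgEquiv.mul_apply, hφ₀, hφ₀, hφ₀, AlgEquiv.mul_apply, RingEquiv.apply_symm_apply] }
  have hφ : ∀ σ, φ σ = φ₀ σ := fun _ => rfl
  have hinj : Function.Injective φ := by
    intro σ τ h
    apply AlgEquiv.ext
    intro y
    have h1 : φ₀ σ (g.symm y) = φ₀ τ (g.symm y) := AlgEquiv.congr_fun h (g.symm y)
    rw [hφ₀, hφ₀, RingEquiv.apply_symm_apply] at h1
    exact g.symm.injective h1
  have hmem : ∀ σ, φ σ ∈ S.fixingSubgroup := by
    intro σ
    rw [IntermediateField.mem_fixingSubgroup_iff]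
    intro x hx
    obtain ⟨c, hc⟩ := hgS x hx
    change φ₀ σ x = x
    rw [hφ₀, hc, AlgEquiv.commutes, ← hc, RingEquiv.symm_apply_apply]
  -- bijectivity onto `S.fixingSubgroup` by counting
  haveI := finiteDimensional_extendScalars_lift S
  haveI := isGalois_extendScalars_lift S
  let φ' := φ.codRestrict S.fixingSubgroup hmem
  have hinj' : Function.Injective φ' := fun σ τ h => hinj (congrArg Subtype.val h)
  have hcard : Nat.card S.fixingSubgroup ≤ Nat.card (Subfield.extendScalars (lift_toSubfield_le S)
      ≃ₐ[(lift S).toSubfield] Subfield.extendScalars (lift_toSubfield_le S)) := by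
    rw [IsGalois.card_fixingSubgroup_eq_finrank, IsGalois.card_aut_eq_finrank,
      finrank_extendScalars_lift]
  have hbij : Function.Bijective φ' := hinj'.bijective_of_nat_card_le hcard
  refine ⟨MulEquiv.ofBijective φ' hbij, fun σ x => ?_⟩
  change (((φ₀ σ) x : L) : Ω) = _
  rw [hφ₀, hg', hgx]

end Rebase

/-! ### The tower between the fixed fields of `B ≤ A` -/

section Tower

variable {M : Subfield Ω} {L : IntermediateField M Ω}

/-- Fixed fields are antitone, at the level of subfields of `Ω`. [folklore] -/
theorem lift_fixedField_toSubfield_mono {A B : Subgroup (L ≃ₐ[M] L)} (h : B ≤ A) :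
    (lift (fixedField A)).toSubfield ≤ (lift (fixedField B)).toSubfield := by
  intro x hx
  have hx' := (mem_lift ⟨x, lift_le _ hx⟩).mp hx
  refine (mem_lift ⟨x, lift_le _ hx⟩).mpr ?_
  rw [IntermediateField.mem_fixedField_iff] at hx' ⊢
  exact fun σ hσ => hx' σ (h hσ)

/-- **The Galois step below a normal subgroup of prime index**: for `H' ≤ A ≤ Gal(L|M)` with
`H'` normalised by `A` and `(A : H') = ℓ`, the fixed field of `H'` is Galois of degree `ℓ`
over the fixed field of `A` (inside `Ω`). Proof by rebasing `L` over `L^A`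
(`exists_rebaseAutEquiv`): `H'` becomes a normal subgroup of `Gal(L|L^A) = A`. [folklore] -/
theorem isGalois_finrank_fixedField_of_normal [FiniteDimensional M L] [IsGalois M L]
    {A H' : Subgroup (L ≃ₐ[M] L)} (hH'A : H' ≤ A) (hnorm : ∀ s ∈ A, ∀ h ∈ H', s * h * s⁻¹ ∈ H') :
    ∃ h : (lift (fixedField A)).toSubfield ≤ (lift (fixedField H')).toSubfield,
      Module.finrank (lift (fixedField A)).toSubfield (Subfield.extendScalars h) = H'.relIndex A ∧
      IsGalois (lift (fixedField A)).toSubfield (Subfield.extendScalars h) := by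
  classical
  have hSA : (fixedField A).fixingSubgroup = A := IntermediateField.fixingSubgroup_fixedField A
  obtain ⟨ψ, hψ⟩ := exists_rebaseAutEquiv (fixedField A)
  haveI := finiteDimensional_extendScalars_lift (fixedField A)
  haveI := isGalois_extendScalars_lift (fixedField A)
  -- `H'` inside the rebased Galois group
  let H'' : Subgroup (Subfield.extendScalars (lift_toSubfield_le (fixedField A))
      ≃ₐ[(lift (fixedField A)).toSubfield]
      Subfield.extendScalars (lift_toSubfield_le (fixedField A))) :=
    (H'.subgroupOf (fixedField A).fixingSubgroup).comap ψ.toMonoidHom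
  have hH''mem : ∀ τ, τ ∈ H'' ↔ ((ψ τ : (fixedField A).fixingSubgroup) : L ≃ₐ[M] L) ∈ H' :=
    fun τ => by
      simp only [H'', Subgroup.mem_comap, Subgroup.mem_subgroupOf, MulEquiv.coe_toMonoidHom]
  haveI hH''N : H''.Normal := by
    refine ⟨fun τ hτ σ => ?_⟩
    rw [hH''mem] at hτ ⊢
    have hσA : ((ψ σ : (fixedField A).fixingSubgroup) : L ≃ₐ[M] L) ∈ A := hSA.le (ψ σ).2
    rw [map_mul, map_mul, map_inv, Subgroup.coe_mul, Subgroup.coe_mul, Subgroup.coe_inv]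
    exact hnorm _ hσA _ hτ
  haveI : IsGalois (lift (fixedField A)).toSubfield (fixedField H'') :=
    IsGalois.of_fixedField_normal_subgroup H''
  -- its degree is `(A : H')`
  have hindex : H''.index = H'.relIndex A := by
    have h1 : H''.index = (H'.subgroupOf (fixedField A).fixingSubgroup).index :=
      Subgroup.index_comap_of_surjective _ ψ.surjective
    rw [h1, Subgroup.relIndex, hSA]
  have hdeg : Module.finrank (lift (fixedField A)).toSubfield (fixedField H'') = H'.relIndex A := by
    rw [IntermediateField.finrank_eq_fixingSubgroup_index, IntermediateField.fixingSubgroup_fixedField,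
      hindex]
  -- the fixed field of `H''` has the same underlying subfield of `Ω` as that of `H'`
  have hsub : (lift (fixedField H'')).toSubfield = (lift (fixedField H')).toSubfield := by
    ext x
    constructor
    · intro hx
      have hxL' : x ∈ Subfield.extendScalars (lift_toSubfield_le (fixedField A)) := lift_le _ hx
      have hxL : x ∈ L := (mem_extendScalars_lift_iff (fixedField A) x).mp hxL'
      have hfix := (mem_lift ⟨x, hxL'⟩).mp hx
      rw [IntermediateField.mem_fixedField_iff] at hfix
      refine (mem_lift ⟨x, hxL⟩).mpr ?_
      rw [IntermediateField.mem_fixedField_iff]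
      intro τ' hτ'
      have hτ'A : τ' ∈ (fixedField A).fixingSubgroup := hSA.ge (hH'A hτ')
      have hτ : ψ.symm ⟨τ', hτ'A⟩ ∈ H'' := by
        rw [hH''mem, MulEquiv.apply_symm_apply]
        exact hτ'
      have h1 := congrArg
        (fun w : Subfield.extendScalars (lift_toSubfield_le (fixedField A)) => (w : Ω)) (hfix _ hτ)
      have h2 := hψ (ψ.symm ⟨τ', hτ'A⟩) ⟨x, hxL⟩
      rw [MulEquiv.apply_symm_apply] at h2
      apply Subtype.ext
      exact h2.trans h1
    · intro hx
      have hxL : x ∈ L := lift_le _ hx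
      have hxL' : x ∈ Subfield.extendScalars (lift_toSubfield_le (fixedField A)) :=
        (mem_extendScalars_lift_iff (fixedField A) x).mpr hxL
      have hfix := (mem_lift ⟨x, hxL⟩).mp hx
      rw [IntermediateField.mem_fixedField_iff] at hfix
      refine (mem_lift ⟨x, hxL'⟩).mpr ?_
      rw [IntermediateField.mem_fixedField_iff]
      intro τ hτ
      rw [hH''mem] at hτ
      have h1 := congrArg (fun w : L => (w : Ω)) (hfix _ hτ)
      have h2 := hψ τ ⟨x, hxL⟩
      apply Subtype.ext
      exact h2.symm.trans h1
  -- transport to `Subfield.extendScalars h`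
  have hle : (lift (fixedField A)).toSubfield ≤ (lift (fixedField H')).toSubfield :=
    lift_fixedField_toSubfield_mono hH'A
  have key : Subfield.extendScalars hle = lift (fixedField H'') :=
    IntermediateField.toSubfield_injective (by rw [Subfield.extendScalars_toSubfield, hsub])
  refine ⟨hle, ?_, ?_⟩
  · rw [key, ← hdeg]
    exact (liftAlgEquiv (fixedField H'')).toLinearEquiv.finrank_eq.symm
  · rw [key]
    exact IsGalois.of_algEquiv (liftAlgEquiv (fixedField H''))

/-- **The fixed field of `B` is reached from the fixed field of `A` by a tower of Galois
extensions of prime degrees `≠ p`**, for subgroups `B ≤ A` of the group of a finite Galois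
`L | M` with `[A, A] ≤ B` and `p ∤ (A : B)` ("`K₀ʳ/K₀ⁱ` is an Abelian extension of order prime
to `p`, whence a tower of Abelian extensions of prime degrees `lᵢ ≠ p`"). By induction on
`(A : B)`: split off a subgroup `B ≤ H' < A` normalised by `A` of prime index
(`exists_normal_prime_relIndex_of_commutator_mem`), a Galois step of degree `(A : H') ≠ p`
(`isGalois_finrank_fixedField_of_normal`), and continue with `(H', B)`.
[cite: CossartPiltant2008, proof of Thm. 8.1 (HAL Thm. 7.2, p. 20)] -/
theorem isPrimeGaloisTower_fixedField [FiniteDimensional M L] [IsGalois M L] (p : ℕ) (n : ℕ) :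
    ∀ (A B : Subgroup (L ≃ₐ[M] L)), B ≤ A → (∀ s ∈ A, ∀ t ∈ A, s * t * s⁻¹ * t⁻¹ ∈ B) →
      ¬ p ∣ B.relIndex A → B.relIndex A = n →
      IsPrimeGaloisTower p (lift (fixedField A)).toSubfield (lift (fixedField B)).toSubfield := by
  induction n using Nat.strong_induction_on with
  | _ n ih =>
  intro A B hBA hcomm hp hn
  by_cases hAB : A ≤ B
  · have hEq : A = B := le_antisymm hAB hBA
    subst hEq
    exact IsPrimeGaloisTower.refl _
  have hlt : B < A := lt_of_le_of_ne hBA (fun h => hAB (h ▸ le_rfl))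
  obtain ⟨H', hBH', hH'A, hnorm, hprime⟩ :=
    exists_normal_prime_relIndex_of_commutator_mem hlt hcomm
  have hmul : B.relIndex H' * H'.relIndex A = B.relIndex A :=
    Subgroup.relIndex_mul_relIndex B H' A hBH' hH'A.le
  have hℓp : H'.relIndex A ≠ p := by
    intro h
    apply hp
    rw [← hmul, h]
    exact dvd_mul_left p _
  -- the first step
  have hstep : IsPrimeGaloisStep p (lift (fixedField A)).toSubfield
      (lift (fixedField H')).toSubfield := by
    obtain ⟨h, hdeg, hgal⟩ := isGalois_finrank_fixedField_of_normal hH'A.le hnorm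
    exact ⟨h, H'.relIndex A, hprime, hℓp, hdeg, hgal⟩
  -- recursion on `(H', B)`
  have h0 : 0 < B.relIndex H' := by
    rw [Subgroup.relIndex]
    exact Nat.pos_of_ne_zero Subgroup.index_ne_zero_of_finite
  have hlt' : B.relIndex H' < n := by
    rw [← hn, ← hmul]
    calc B.relIndex H' = B.relIndex H' * 1 := (mul_one _).symm
      _ < B.relIndex H' * H'.relIndex A := Nat.mul_lt_mul_of_pos_left hprime.one_lt h0
  have htower := ih _ hlt' H' B hBH' (fun s hs t ht => hcomm s (hH'A.le hs) t (hH'A.le ht))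
    (fun h => hp (by rw [← hmul]; exact Dvd.dvd.mul_right h _)) rfl
  exact IsPrimeGaloisTower.step hstep htower

end Tower

end Literature.AlgebraicGeometry.Resolution

end
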